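import Mathlib
import Summits.ResolutionOfSingularities.ResolutionOfSingularities.Theorems.HomologicalConductorPersistenceCyclicTransferCoinduced
import HarnessLib

/-!
# Crux `Persistence` (stmt-16484) / rung S-2 `PersistenceSurface` (stmt-19970) — cyclic transfer, part 5:
# the SYZYGY INPUT (T-V-b) for FROBENIUS-TYPE covers, and the Veronese lemma T-V at level `ca³`
# (chain W4.4b, seat res-L1-w44b-stub-4 gen 4; planner's VERONESE LEMMA T-V, S2-BRIEF v1.2)

[OURS · L1 w44b] Nothing here is a statement of the manuscript under review (Hironaka 2017); AI-written, weaker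
than expert review.

SETTING as in parts 1–4 (`U = V^σ`, `σ ^ d = 1`, `d ∈ Uˣ`, `ω` with character orthogonality); `Hom_U(V, N)` is
Mathlib's coextension `((ModuleCat.restrictScalars (algebraMap U V)).obj (ModuleCat.of V V)) →ₗ[U] N`.

HYPOTHESIS (Frobenius type): `Hom_U(V, U)` is a finitely generated projective `V`-module — e.g. FREE OF RANK ONE on
the Reynolds operator when the Reynolds pairing `w ↦ (v ↦ ρ(v w))` is perfect (`finite_projective_of_reynoldsPairing`:
every `U`-linear `φ : V → U` is `ρ(– w)` for a unique `w`),
which is the case for `V ⊇ V^G` normal and unramified in codimension one (Veronese subrings `R^{(n)} ⊂ R` of a normal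
graded domain with isolated singularity; quotient singularities by small groups).  [That last algebraic fact is NOT
proved here; it enters as the projectivity hypothesis.]

RESULTS.
* `isSyzygy_two_ker` — over any commutative ring: the kernel of a linear map between finitely generated projective
  modules is a second syzygy of its cokernel.
* `coindPost`, functoriality pieces: `Hom_U(V, –)` on maps, on `Fin m → U`, on retracts, on kernels
  (left exactness): `exists_linearEquiv_coind_pi`, `finite_projective_coind`, `exists_linearEquiv_coind_ker`.
* **`exists_isSyzygy_two_coind`** — T-V-b at level 2: if `K` is a second syzygy of a finitely generated `U`-module
  then `Hom_U(V, K)` is a second syzygy of a finitely generated `V`-module.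
* **`mul_mem_cohomologyAnnihilatorOfDegree_three`** — THE VERONESE LEMMA T-V (kernel form, level 3):
  `c ∈ ca³(V)` of character `ω^γ`, `a ∈ 𝔞_γ` ⟹ `a c ∈ ca³(U)`; pure-power form `pow_mem_cohomologyAnnihilatorOfDegree_three`
  (`σ w = ω w`, `w ∈ ca³(V)` ⟹ `w^d ∈ ca³(U)`).  Over a two-dimensional Gorenstein normal `V`, `ca = ca³`, so this is
  «`ca(R^G) ⊇ 𝔞·(ca(R) ∩ R^G)`» of S2-BRIEF v1.2 for such `R`.

References: Iyengar–Takahashi, IMRN 2016, arXiv:1404.1476, §2 and Remark 2.13 [`IyengarTakahashi2014`]; folklore.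
-/

-- single-problem summit: the doubled namespace component `ResolutionOfSingularities` is forced
set_option linter.dupNamespace false

noncomputable section

open CategoryTheory Literature.RingTheory.CohomologyAnnihilator
open Summit.ResolutionOfSingularities.ResolutionOfSingularities.Theorems.NoZeno.SandwichCluster
open Summit.ResolutionOfSingularities.ResolutionOfSingularities.Theorems.HomologicalConductor.PersistenceSurfaceHullCover
open Summit.ResolutionOfSingularities.ResolutionOfSingularities.Theorems.HomologicalConductor.PersistenceCyclicTransferFamily
open Summit.ResolutionOfSingularities.ResolutionOfSingularities.Theorems.HomologicalConductor.PersistenceCyclicTransferGeneral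
open Summit.ResolutionOfSingularities.ResolutionOfSingularities.Theorems.HomologicalConductor.PersistenceCyclicTransferStable
open Summit.ResolutionOfSingularities.ResolutionOfSingularities.Theorems.HomologicalConductor.PersistenceCyclicTransferCoinduced

universe u

namespace Summit.ResolutionOfSingularities.ResolutionOfSingularities.Theorems.HomologicalConductor.PersistenceCyclicTransferSyzygy

/-! ## Kernels of maps between projectives are second syzygies -/

/-- Over any commutative ring: the kernel of a linear map `F : P → Q` between finitely generated projective modules
is a second syzygy of `Q ⧸ range F` (`0 → ker F → P → range F → 0`, `0 → range F → Q → Q/range F → 0`). [folklore] -/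
theorem isSyzygy_two_ker {A : Type u} [CommRing A] {P Q : Type u} [AddCommGroup P] [Module A P] [AddCommGroup Q]
    [Module A Q] [Module.Finite A P] [Module.Projective A P] [Module.Finite A Q] [Module.Projective A Q]
    (F : P →ₗ[A] Q) :
    IsSyzygy 2 (ModuleCat.of A (Q ⧸ LinearMap.range F)) (ModuleCat.of A (LinearMap.ker F)) := by
  -- `0 → range F → Q → Q/range F → 0`
  obtain ⟨w₂, hS₂⟩ := exists_shortExact_of_linearMap (Y := ModuleCat.of A (LinearMap.range F))
    (M := ModuleCat.of A Q) (X := ModuleCat.of A (Q ⧸ LinearMap.range F)) (LinearMap.range F).subtype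
    (LinearMap.range F).mkQ Subtype.val_injective (Submodule.mkQ_surjective _) (LinearMap.exact_subtype_mkQ _)
  have h₁ : IsSyzygy 1 (ModuleCat.of A (Q ⧸ LinearMap.range F)) (ModuleCat.of A (LinearMap.range F)) :=
    isSyzygy_one_iff.mpr ⟨ModuleCat.of A Q, inferInstance,
      (IsProjective.iff_projective (R := A) Q).mp inferInstance, _, _, w₂, hS₂⟩
  -- `0 → ker F → P → range F → 0`
  have hex : Function.Exact (LinearMap.ker F).subtype F.rangeRestrict := by
    rw [LinearMap.exact_iff, LinearMap.ker_rangeRestrict, Submodule.range_subtype]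
  obtain ⟨w₁, hS₁⟩ := exists_shortExact_of_linearMap (Y := ModuleCat.of A (LinearMap.ker F))
    (M := ModuleCat.of A P) (X := ModuleCat.of A (LinearMap.range F)) (LinearMap.ker F).subtype
    F.rangeRestrict Subtype.val_injective F.surjective_rangeRestrict hex
  exact ⟨ModuleCat.of A (LinearMap.range F), ModuleCat.of A P, h₁, inferInstance,
    (IsProjective.iff_projective (R := A) P).mp inferInstance, _, _, w₁, hS₁⟩

/-! ## Functoriality of the coextension `Hom_U(V, –)` -/

variable {U V : Type u} [CommRing U] [CommRing V] [Algebra U V]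

/-- Post-composition `Hom_U(V, N) → Hom_U(V, N')` with a `U`-linear `g : N → N'` is `V`-linear for the coextended
structures. [folklore] -/
theorem exists_coindPost {N N' : Type u} [AddCommGroup N] [Module U N] [AddCommGroup N'] [Module U N']
    (g : N →ₗ[U] N') :
    ∃ G : (((ModuleCat.restrictScalars (algebraMap U V)).obj (ModuleCat.of V V)) →ₗ[U] N) →ₗ[V]
        (((ModuleCat.restrictScalars (algebraMap U V)).obj (ModuleCat.of V V)) →ₗ[U] N'),
      ∀ φ, G φ = g ∘ₗ φ :=
  ⟨{ toFun := fun φ => g ∘ₗ φ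
     map_add' := fun _ _ => LinearMap.ext fun _ => map_add g _ _
     map_smul' := fun _ _ => LinearMap.ext fun _ => rfl }, fun _ => rfl⟩

/-- `Hom_U(V, Uᵐ) ≅ Hom_U(V, U)ᵐ`, `V`-linearly. [folklore] -/
theorem exists_linearEquiv_coind_pi (m : ℕ) :
    Nonempty ((((ModuleCat.restrictScalars (algebraMap U V)).obj (ModuleCat.of V V)) →ₗ[U] (Fin m → U)) ≃ₗ[V]
      (Fin m → (((ModuleCat.restrictScalars (algebraMap U V)).obj (ModuleCat.of V V)) →ₗ[U] U))) :=
  ⟨{ toFun := fun φ i => (LinearMap.proj i) ∘ₗ φ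
     map_add' := fun φ ψ => by funext i; rfl
     map_smul' := fun w φ => by funext i; rfl
     invFun := fun ψ => LinearMap.pi ψ
     left_inv := fun φ => by apply LinearMap.ext; intro v; funext i; rfl
     right_inv := fun ψ => by funext i; rfl }⟩

/-- **`Hom_U(V, P)` is finitely generated projective over `V`** for `P` finitely generated projective over `U`,
as soon as `Hom_U(V, U)` is (`P` is a retract of some `Uᵐ`, and `Hom_U(V, –)` preserves retracts and finite
products). [folklore] -/
theorem finite_projective_coind
    [Module.Finite V (((ModuleCat.restrictScalars (algebraMap U V)).obj (ModuleCat.of V V)) →ₗ[U] U)]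
    [Module.Projective V (((ModuleCat.restrictScalars (algebraMap U V)).obj (ModuleCat.of V V)) →ₗ[U] U)]
    (P : Type u) [AddCommGroup P] [Module U P] [Module.Finite U P] [Module.Projective U P] :
    Module.Finite V (((ModuleCat.restrictScalars (algebraMap U V)).obj (ModuleCat.of V V)) →ₗ[U] P) ∧
      Module.Projective V (((ModuleCat.restrictScalars (algebraMap U V)).obj (ModuleCat.of V V)) →ₗ[U] P) := by
  obtain ⟨m, f, hf⟩ := Module.Finite.exists_fin' U P
  obtain ⟨s, hs⟩ := Module.projective_lifting_property f (LinearMap.id : P →ₗ[U] P) hf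
  obtain ⟨F, hF⟩ := exists_coindPost (U := U) (V := V) f
  obtain ⟨S, hS⟩ := exists_coindPost (U := U) (V := V) s
  obtain ⟨e⟩ := exists_linearEquiv_coind_pi (U := U) (V := V) m
  have hFS : F ∘ₗ S = LinearMap.id := by
    apply LinearMap.ext
    intro φ
    rw [LinearMap.comp_apply, hS, hF, ← LinearMap.comp_assoc, hs, LinearMap.id_comp, LinearMap.id_apply]
  haveI : Module.Finite V (((ModuleCat.restrictScalars (algebraMap U V)).obj (ModuleCat.of V V)) →ₗ[U]
      (Fin m → U)) := Module.Finite.equiv e.symm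
  haveI : Module.Projective V
      (Fin m → (((ModuleCat.restrictScalars (algebraMap U V)).obj (ModuleCat.of V V)) →ₗ[U] U)) :=
    Module.Projective.of_equiv (DFinsupp.linearEquivFunOnFintype (R := V)
      (M := fun _ : Fin m => (((ModuleCat.restrictScalars (algebraMap U V)).obj (ModuleCat.of V V)) →ₗ[U] U)))
  haveI : Module.Projective V (((ModuleCat.restrictScalars (algebraMap U V)).obj (ModuleCat.of V V)) →ₗ[U]
      (Fin m → U)) := Module.Projective.of_equiv e.symm
  refine ⟨Module.Finite.of_surjective F fun φ => ⟨S φ, ?_⟩, Module.Projective.of_split S F hFS⟩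
  exact LinearMap.congr_fun hFS φ

/-- **Left exactness**: for `U`-linear `g : N → N'`, `Hom_U(V, ker g) ≅ ker (Hom_U(V, g))`, `V`-linearly.
[folklore] -/
theorem exists_linearEquiv_coind_ker {N N' : Type u} [AddCommGroup N] [Module U N] [AddCommGroup N']
    [Module U N'] (g : N →ₗ[U] N')
    (G : (((ModuleCat.restrictScalars (algebraMap U V)).obj (ModuleCat.of V V)) →ₗ[U] N) →ₗ[V]
      (((ModuleCat.restrictScalars (algebraMap U V)).obj (ModuleCat.of V V)) →ₗ[U] N'))
    (hG : ∀ φ, G φ = g ∘ₗ φ) :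
    Nonempty ((((ModuleCat.restrictScalars (algebraMap U V)).obj (ModuleCat.of V V)) →ₗ[U] (LinearMap.ker g))
      ≃ₗ[V] (LinearMap.ker G)) := by
  have h1 : ∀ ψ : ((ModuleCat.restrictScalars (algebraMap U V)).obj (ModuleCat.of V V)) →ₗ[U] (LinearMap.ker g),
      (LinearMap.ker g).subtype ∘ₗ ψ ∈ LinearMap.ker G := fun ψ => by
    rw [LinearMap.mem_ker, hG, ← LinearMap.comp_assoc, LinearMap.comp_ker_subtype, LinearMap.zero_comp]
  have h2 : ∀ (φ : LinearMap.ker G) (v), (φ.1 v) ∈ LinearMap.ker g := fun φ v => by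
    have h := φ.2
    rw [LinearMap.mem_ker, hG] at h
    exact LinearMap.congr_fun h v
  exact ⟨{ toFun := fun ψ => ⟨(LinearMap.ker g).subtype ∘ₗ ψ, h1 ψ⟩
           map_add' := fun ψ ψ' => by
             apply Subtype.ext
             exact LinearMap.ext fun v => map_add (LinearMap.ker g).subtype _ _
           map_smul' := fun w ψ => by apply Subtype.ext; apply LinearMap.ext; intro v; rfl
           invFun := fun φ => LinearMap.codRestrict (LinearMap.ker g) φ.1 (h2 φ)
           left_inv := fun ψ => by apply LinearMap.ext; intro v; rfl
           right_inv := fun φ => by apply Subtype.ext; apply LinearMap.ext; intro v; rfl }⟩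

/-! ## T-V-b at level two -/

/-- **T-V-b (level 2).**  If `Hom_U(V, U)` is a finitely generated projective `V`-module, then the coextension
`Hom_U(V, K)` of every second syzygy `K` of a finitely generated `U`-module is a second syzygy of a finitely
generated `V`-module: with `0 → K → P₂ → K' → 0`, `K' ↪ P₁`, left exactness gives
`Hom_U(V, K) ≅ ker(Hom_U(V, P₂) → Hom_U(V, P₁))`, a second syzygy of the cokernel (`isSyzygy_two_ker`). [folklore] -/
theorem exists_isSyzygy_two_coind
    [Module.Finite V (((ModuleCat.restrictScalars (algebraMap U V)).obj (ModuleCat.of V V)) →ₗ[U] U)]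
    [Module.Projective V (((ModuleCat.restrictScalars (algebraMap U V)).obj (ModuleCat.of V V)) →ₗ[U] U)]
    (X K : ModuleCat.{u} U) (_hX : Module.Finite U X) (hK : IsSyzygy 2 X K) :
    ∃ X' : ModuleCat.{u} V, Module.Finite V X' ∧ IsSyzygy 2 X'
      (ModuleCat.of V (((ModuleCat.restrictScalars (algebraMap U V)).obj (ModuleCat.of V V)) →ₗ[U] K)) := by
  obtain ⟨K', P₂, h₁, hP₂fin, hP₂proj, ι, π, w, hS⟩ := hK
  obtain ⟨P₁, hP₁fin, hP₁proj, ι', π', w', hS'⟩ := isSyzygy_one_iff.mp h₁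
  obtain ⟨hι, hπ, hιπ⟩ := shortExact_unpack hS
  obtain ⟨hι', -, -⟩ := shortExact_unpack hS'
  haveI := hP₂fin
  haveI := hP₁fin
  haveI : Module.Projective U P₂ := moduleProjective_of_projective P₂ hP₂proj
  haveI : Module.Projective U P₁ := moduleProjective_of_projective P₁ hP₁proj
  -- `g = ι' ∘ π : P₂ → P₁`, `ker g = range ι ≅ K`
  let g : P₂ →ₗ[U] P₁ := ι'.hom ∘ₗ π.hom
  have hkerg : LinearMap.ker g = LinearMap.range ι.hom := by
    rw [LinearMap.ker_comp, LinearMap.ker_eq_bot.mpr hι', Submodule.comap_bot]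
    exact (LinearMap.exact_iff.mp hιπ)
  let eK : K ≃ₗ[U] LinearMap.ker g :=
    (LinearEquiv.ofInjective ι.hom hι).trans (LinearEquiv.ofEq _ _ hkerg.symm)
  -- the `V`-side
  obtain ⟨G, hG⟩ := exists_coindPost (U := U) (V := V) g
  obtain ⟨hfin₂, hproj₂⟩ := finite_projective_coind (U := U) (V := V) P₂
  obtain ⟨hfin₁, hproj₁⟩ := finite_projective_coind (U := U) (V := V) P₁
  have h2 := isSyzygy_two_ker G
  obtain ⟨eker⟩ := exists_linearEquiv_coind_ker (U := U) (V := V) g G hG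
  obtain ⟨EK, hEK⟩ := exists_coindPost (U := U) (V := V) eK.toLinearMap
  obtain ⟨EK', hEK'⟩ := exists_coindPost (U := U) (V := V) eK.symm.toLinearMap
  let eCoind : (((ModuleCat.restrictScalars (algebraMap U V)).obj (ModuleCat.of V V)) →ₗ[U] K) ≃ₗ[V]
      (((ModuleCat.restrictScalars (algebraMap U V)).obj (ModuleCat.of V V)) →ₗ[U] (LinearMap.ker g)) :=
    { EK with
      invFun := EK'
      left_inv := fun φ => by
        change EK' (EK φ) = φ
        rw [hEK, hEK', ← LinearMap.comp_assoc]
        apply LinearMap.ext; intro v; simp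
      right_inv := fun φ => by
        change EK (EK' φ) = φ
        rw [hEK', hEK, ← LinearMap.comp_assoc]
        apply LinearMap.ext; intro v; simp }
  refine ⟨ModuleCat.of V ((((ModuleCat.restrictScalars (algebraMap U V)).obj (ModuleCat.of V V)) →ₗ[U] P₁) ⧸
    LinearMap.range G), inferInstance, ?_⟩
  exact h2.of_iso ((eCoind.trans eker).symm.toModuleIso)

/-! ## The Veronese lemma T-V at level `ca³` -/

/-- **VERONESE LEMMA T-V (kernel form, level 3).**  `U`, `V` noetherian, `σ ^ d = 1` with fixed ring `U`
(injective `algebraMap`), `ω ∈ U` a `d`-th root of unity with character orthogonality, `d ∈ Uˣ`, and `Hom_U(V, U)`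
finitely generated projective over `V` (Frobenius type).  Then for `c ∈ ca³(V)` of character `ω^γ` and `a` in the
isotypic product ideal `𝔞_γ = ⋂_j V_{[j]}V_{[-γ-j]}` (decomposition data), `a c ∈ ca³(U)`.
For `γ = 0` this is «`ca³(V^G) ⊇ 𝔞·(ca³(V) ∩ V^G)`», `𝔞 = V^G ∩ ⋂_{j≠0} V_{[j]}V_{[-j]}`. [folklore] -/
theorem mul_mem_cohomologyAnnihilatorOfDegree_three [IsNoetherianRing U] [IsNoetherianRing V]
    [Module.Finite V (((ModuleCat.restrictScalars (algebraMap U V)).obj (ModuleCat.of V V)) →ₗ[U] U)]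
    [Module.Projective V (((ModuleCat.restrictScalars (algebraMap U V)).obj (ModuleCat.of V V)) →ₗ[U] U)]
    (σ : V →ₐ[U] V) {d : ℕ} (hd : 0 < d) (hσd : σ ^ d = 1)
    (hfix : ∀ v : V, σ v = v → ∃ u : U, algebraMap U V u = v) (hinj : Function.Injective (algebraMap U V))
    (ω : U) (hωd : ω ^ d = 1) (horth : ∀ m : ℕ, ¬ d ∣ m → ∑ i ∈ Finset.range d, ω ^ (m * i) = 0)
    (hdU : IsUnit ((d : ℕ) : U)) {c : V} (hc3 : c ∈ cohomologyAnnihilatorOfDegree V 3) (gc : ℕ)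
    (hc : σ c = algebraMap U V ω ^ gc * c) {a : V}
    (ha : ∀ j' : Fin d, ∃ (m : ℕ) (b b' : Fin m → V) (l : ℕ), (∀ k, σ (b k) = algebraMap U V ω ^ (j' : ℕ) * b k) ∧
      (∀ k, σ (b' k) = algebraMap U V ω ^ l * b' k) ∧ d ∣ (j' : ℕ) + l + gc ∧ ∑ k, b k * b' k = a)
    (u : U) (hu : algebraMap U V u = a * c) : u ∈ cohomologyAnnihilatorOfDegree U 3 :=
  mul_mem_cohomologyAnnihilatorOfDegree_of_coinduced_syzygy σ hd hσd hfix hinj ω hωd horth hdU 2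
    (fun X K hX hK => exists_isSyzygy_two_coind X K hX hK) hc3 gc hc ha u hu

/-- **T-V, pure-power form at level 3**: `σ w = ω w`, `w ∈ ca³(V)`, `algebraMap u = w ^ d` ⟹ `u ∈ ca³(U)`
(Frobenius-type cover). [folklore] -/
theorem pow_mem_cohomologyAnnihilatorOfDegree_three [IsNoetherianRing U] [IsNoetherianRing V]
    [Module.Finite V (((ModuleCat.restrictScalars (algebraMap U V)).obj (ModuleCat.of V V)) →ₗ[U] U)]
    [Module.Projective V (((ModuleCat.restrictScalars (algebraMap U V)).obj (ModuleCat.of V V)) →ₗ[U] U)]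
    (σ : V →ₐ[U] V) {d : ℕ} (hd : 0 < d) (hσd : σ ^ d = 1)
    (hfix : ∀ v : V, σ v = v → ∃ u : U, algebraMap U V u = v) (hinj : Function.Injective (algebraMap U V))
    (ω : U) (hωd : ω ^ d = 1) (horth : ∀ m : ℕ, ¬ d ∣ m → ∑ i ∈ Finset.range d, ω ^ (m * i) = 0)
    (hdU : IsUnit ((d : ℕ) : U)) {w : V} (hw3 : w ∈ cohomologyAnnihilatorOfDegree V 3)
    (hw : σ w = algebraMap U V ω * w) (u : U) (hu : algebraMap U V u = w ^ d) :
    u ∈ cohomologyAnnihilatorOfDegree U 3 := by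
  refine (mem_cohomologyAnnihilatorOfDegree_succ_iff_forall_isSyzygy u).mpr fun X K hX hK => ?_
  obtain ⟨X', hX', hK'⟩ := exists_isSyzygy_two_coind (U := U) (V := V) X K hX hK
  have hcK := (mem_cohomologyAnnihilatorOfDegree_succ_iff_forall_isSyzygy w).mp hw3 X' _ hX' hK'
  exact StablyAnnihilates.of_coinduced_pow σ hd hσd hfix hinj ω hωd horth hdU hw K hcK u hu

/-! ## The Frobenius hypothesis from a perfect Reynolds pairing -/

/-- The REYNOLDS PAIRING criterion for the Frobenius hypothesis: if every `U`-linear `φ : V → U` is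
`v ↦ ρ(v w)` for a UNIQUE `w ∈ V` (perfect pairing; `ρ` any `U`-linear form, e.g. the Reynolds operator), then
`Hom_U(V, U) ≅ V` is free of rank one over `V`, in particular finitely generated projective. [folklore] -/
theorem finite_projective_of_reynoldsPairing (ρ : V →ₗ[U] U)
    (hpair : ∀ φ : ((ModuleCat.restrictScalars (algebraMap U V)).obj (ModuleCat.of V V)) →ₗ[U] U,
      ∃! w : V, ∀ v : V, φ v = ρ (v * w)) :
    Module.Finite V (((ModuleCat.restrictScalars (algebraMap U V)).obj (ModuleCat.of V V)) →ₗ[U] U) ∧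
      Module.Projective V (((ModuleCat.restrictScalars (algebraMap U V)).obj (ModuleCat.of V V)) →ₗ[U] U) := by
  let toW : V → ((ModuleCat.restrictScalars (algebraMap U V)).obj (ModuleCat.of V V)) := fun v => v
  let ofW : ((ModuleCat.restrictScalars (algebraMap U V)).obj (ModuleCat.of V V)) → V := fun w => w
  let Φ : V →ₗ[V] (((ModuleCat.restrictScalars (algebraMap U V)).obj (ModuleCat.of V V)) →ₗ[U] U) :=
    { toFun := fun w =>
        { toFun := fun v => ρ (ofW v * w)
          map_add' := fun v v' => by
            change ρ ((ofW v + ofW v') * w) = _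
            rw [add_mul, map_add]
          map_smul' := fun r v => by
            change ρ (algebraMap U V r * ofW v * w) = r • ρ (ofW v * w)
            rw [mul_assoc, ← Algebra.smul_def, map_smul] }
      map_add' := fun w w' => by
        apply LinearMap.ext
        intro v
        change ρ (ofW v * (w + w')) = ρ (ofW v * w) + ρ (ofW v * w')
        rw [mul_add, map_add]
      map_smul' := fun w' w => by
        apply LinearMap.ext
        intro v
        change ρ (ofW v * (w' * w)) = ρ (ofW v * w' * w)
        rw [mul_assoc] }
  have hΦ : Function.Bijective Φ := by
    constructor
    · intro w w' h
      obtain ⟨w₀, -, huniq⟩ := hpair (Φ w)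
      have h1 : w = w₀ := huniq w fun v => rfl
      have h2 : w' = w₀ := huniq w' fun v => by rw [h]; rfl
      rw [h1, h2]
    · intro φ
      obtain ⟨w, hw, -⟩ := hpair φ
      exact ⟨w, LinearMap.ext fun v => (hw (ofW v)).symm⟩
  let e := LinearEquiv.ofBijective Φ hΦ
  exact ⟨Module.Finite.equiv e, Module.Projective.of_equiv e⟩

end Summit.ResolutionOfSingularities.ResolutionOfSingularities.Theorems.HomologicalConductor.PersistenceCyclicTransferSyzygy

end
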